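import Summits.QuantumFields.YangMills.Theorems.BalabanUVNodesN17TwoRunShift
import Summits.QuantumFields.BalabanUV.T4Continuum.Spine.NE4.ScaleShiftBareCorner
import Mathlib.Analysis.SpecificLimits.Normed

/-!
# NODE N17 (NE4) — FILE 7: THE N17-SIDE KERNEL SHADOWS OF THE F-E FINDING — under FIRST-ENTRY-ONLY the BOX letter forces geometric flatness of `β_k` in the bare
# coupling (and CRIT-2's marginal-transport toy admits no box letter at all); under the TRANSPORT READING ON RUNS the infrared-matched two-run letter of FILE 6 IS
# pv16's Markov scale shift at the realised coupling — so DEF-1's run letter needs of NE4 exactly that, summably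

Cell `pub-ymgap`, YM-PLAN Track A (HUMAN RULINGS D-0062 ∕ D-0149), WIDTH SEAT `pub-ymgap-dag-n17-w1` (generation 6), CLAIM-2 ∕ INTENT-2 (INBOX l.36706).  Key K3⁸
stmt-QuantumFields-27366 `SpineGivenEndpointR13SepCoPHV` (`--kind proof --supports stmt-QuantumFields-27366 --as helper`, COUNT-NEUTRAL).  Continues FILE 6 (p627997
`…N17TwoRunShift`: the lever keyed on PAIRS OF INFRARED-MATCHED honest runs, texts (TR) ∕ (ER)).

WHY THIS FILE.  The ym-nodeO critics' F-E finding (IDEA-1 g12 located; CRIT-1 g5 confirmed; CRIT-2 g3 E-CRIT2-2 ∕ BN-N; CRIT-1 g6 cross-read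
`Cruxes/EndpointGivenBR13SepCoPH/CRIT-1-CROSSREAD-E-CRIT2-2-geometric-letters.md`; kernel part `Cruxes/EndpointGivenBR13SepCoPH/Idea5g12RunCurrencySketch5.lean` §11·N
`FirstEntryOnly` ∕ `geomRigid_of_firstEntryOnly_fading` ∕ `marginalTransport_not_geomFading`): modulo H_FE′ — NODE 00's free-history β of record depends on a history only through its
FIRST entry (the bare coupling), the later entries entering as gauge-fixing prefactors — and the transport identification (T) — that first-entry dependence IS print's β_{k+1} read at
the coupling transported along the run — the GEOMETRIC BOX letters `ScaleShiftRate` (node N17's `N17At`) and `FadingMemory` are presumptively FALSE at the current record, while RUN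
letters survive.  This file types the two exact kernel shadows of that finding ON NODE N17's SIDE, over a GENERIC `β : HBeta` (the FE text and (T) are INLINE binders; Cruxes∕ files
are not importable from Theorems∕, the critics' names are cited, not re-declared):
§1 `osc_le_of_firstEntryOnly_boxShift` — FE + a box shift modulus `a` ⟹ `|β_k(p) − β_k(q)| ≤ 2a_k` for ALL `p, q ∈ ]0,γ]^{k+1}` (prepend the SAME first entry to both; FE identifies
   the two values of `β_{k+1}`; the box letter compares each with `β_k` of its tail) — NO history modulus is needed, unlike §11·N's `oscillation_le_of_firstEntryOnly_fading`;
   `osc_le_of_firstEntryOnly_scaleShiftRate` — with node N17's `ScaleShiftRate c θ γ`: `2cθ^k`-FLATNESS of `β_k` in the bare coupling on the whole box (the exact content of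
   «box NE4 presumptively false mod H_FE′ + (T)»: the transported one-loop term oscillates by `≍ 1∕k`); `not_scaleShiftRate_transportToy` — CRIT-2's marginal-transport toy
   `β_k(p) := β₀ + α(p 0)²∕(1 + ck(p 0)²)` (α > 0, c ≥ 0; a λ-term, no def) admits NO `ScaleShiftRate c′ θ γ` with `0 ≤ θ < 1` (its γ-vs-γ∕2 oscillation is `≥ 3αγ²∕(4(1+ckγ²)²)`,
   and `(1+ckγ²)²θ^k → 0`).
§2 `twoRunShift_of_runReading` — under (T) READ ON RUNS («along every in-window run `β_k(g_0,…,g_k) = φ_k(g_k)`», [I] (0.20) p. 256's literal «β_{k+1}(g_k)») FILE 6's (TR) IS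
   `|φ_{k+1}(g) − φ_k(g)|` at the common endpoint — pv16's Markov scale shift (`scaleShiftRate_ofMarkov_iff`) at the REALISED coupling, NE4's physical content «one more UV scale at
   the same coupling» and nothing else; `twoRunShift_zero_of_runReading_scaleFree` (scale-free law ⟹ (TR) with `a ≡ 0`); `runReading_ofMarkov` (`FlowStep.ofMarkov` satisfies (T),
   `rfl`); `twoRunShift_ofMarkov_of_scaleShiftRate` (on Markov families the BOX letter gives (TR) with the same modulus: the two keyings AGREE there — their divergence is a
   first-entry phenomenon).
§3 `exists_runConstRemainder_of_runReading_scaleAnchor_endRuns` ∕ `runRemAt_of_runReading_scaleAnchor_endRuns_survContAt` — FILE 6's lever ★ ∕ ★★ BY NAME under (T) on runs: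
   what DEF-1's `RunConstRemainder` ∕ `RunRemAt` need of NE4 is a SUMMABLE Markov scale shift of the read law at realised couplings + (ER) + the anchor (+ (C) at one level).
HONEST SCOPE (A6).  Elementary real bookkeeping over hypothesis SHAPES; the FE text, (T)-on-runs, (TR), (ER), the anchor, (C) are BINDERS inhabited at no θ here; the toy is the
critics' caricature, NOT Bałaban's β; NOTHING is asserted of NODE 00's record (whether H_FE′ ∕ (T) hold there is node00-def ∕ def-T's desk, director-ym №210); NE4 NOT IN PRINT
([Balaban1987RG1] p. 264) and NOT proved in any keying; NOT a proof of `stub_rates13HV` ∕ `stub_expansion13HV` or any K1⁹ stub; N17 NOT discharged (DEPENDENT∕DERIVED row); K0⁷ ∕ K1⁹ ∕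
K3⁸ OPEN; counts UNMOVED (typed 28∕28 · discharged 5∕27 · A 5∕28).  One finite four-torus programme at fixed `ε = L^{−K}`, Bałaban AS PRINTED; the YM mass gap (Clay) is NOT proved by
any of this — R4 closes the conditional finite-𝕋⁴ rung `BalabanLadder.UV` only; nothing continuum ∕ ℝ⁴ ∕ OS.
[I] = [Balaban1987RG1] T. Bałaban, CMP **109** (1987): (0.20) p. 256, Thm 2 p. 259, (1.20)–(1.22) p. 264, Thm 3 p. 264, (2.12)–(2.14) p. 268, §5 p. 298.
-/

noncomputable section

namespace Summit.QuantumFields.YangMills.BalabanUVNodes.N17TwoRunShiftFirstEntry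

open Literature.MathematicalPhysics.QuantumFieldTheory.Balaban1983to89
open Literature.MathematicalPhysics.QuantumFieldTheory.Balaban1983to89.FlowStep
open Literature.MathematicalPhysics.QuantumFieldTheory.Balaban1983to89.T4CouplingMatching (ScaleShiftRate scaleShiftRate_ofMarkov_iff)
open Literature.MathematicalPhysics.QuantumFieldTheory.Balaban1983to89.T4Continuum (T4Family)
open Summit.QuantumFields.YangMills.Theorems.BalabanUVNodesK2JsOfRecord (StepColourData beta0OfJs)
open Summit.QuantumFields.YangMills.Theorems.BalabanUVNodesK2NamedJetsRemAt (ScaleAnchor)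
open Summit.QuantumFields.YangMills.Theorems.BalabanUVNodesK2NamedJetsRunRemAt (RunRemAt RunConstRemainder SurvCont)
open Summit.QuantumFields.BalabanUV.T4Continuum.Spine.NE4.ScaleShiftBareCorner (cons_mem_box)
open Summit.QuantumFields.YangMills.BalabanUVNodes.N17TwoRunShift
  (exists_runConstRemainder_of_twoRunShift_cornerStep_scaleAnchor_endRuns runRemAt_of_twoRunShift_scaleAnchor_endRuns_survContAt)
open Finset Filter Topology

/-! ## §1 Under FIRST-ENTRY-ONLY (H_FE′, inline) the BOX letter forces geometric flatness of `β_k` in the bare coupling -/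

section FirstEntry

variable {β : HBeta} {a : ℕ → ℝ} {γ : ℝ}

/-- **FE + A BOX SHIFT MODULUS ⟹ OSCILLATION DEATH ON THE WHOLE BOX**: if `β` is first-entry-only on the `]0,γ]`-boxes (H_FE′, inline: `β k p = β k q` whenever `p 0 = q 0`) and
`|β_{k+1}(w) − β_k(Fin.tail w)| ≤ a_k` on `]0,γ]^{k+2}` (node N17's box letter with modulus `a`), then `|β_k(p) − β_k(q)| ≤ 2a_k` for ALL `p, q ∈ ]0,γ]^{k+1}`: prepend the SAME
first entry to `p` and to `q`; FE identifies the two values of `β_{k+1}`; the box letter compares each with `β_k` of the tail.  (The N17 twin of idea-5 §11·N's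
`oscillation_le_of_firstEntryOnly_fading`, with NO history modulus at all.) [folklore] -/
theorem osc_le_of_firstEntryOnly_boxShift
    (hFE : ∀ (k : ℕ) (p q : Fin (k + 1) → ℝ), p ∈ Box γ k → q ∈ Box γ k → p 0 = q 0 → β k p = β k q)
    (h : ∀ k (w : Fin (k + 2) → ℝ), w ∈ Box γ (k + 1) → |β (k + 1) w - β k (Fin.tail w)| ≤ a k)
    (k : ℕ) (p q : Fin (k + 1) → ℝ) (hp : p ∈ Box γ k) (hq : q ∈ Box γ k) : |β k p - β k q| ≤ 2 * a k := by
  have hp0 := (mem_box.mp hp) 0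
  have hwp : (Fin.cons (p 0) p : Fin (k + 2) → ℝ) ∈ Box γ (k + 1) := cons_mem_box hp0.1 hp0.2 hp
  have hwq : (Fin.cons (p 0) q : Fin (k + 2) → ℝ) ∈ Box γ (k + 1) := cons_mem_box hp0.1 hp0.2 hq
  have hFE' : β (k + 1) (Fin.cons (p 0) p) = β (k + 1) (Fin.cons (p 0) q) :=
    hFE (k + 1) _ _ hwp hwq (by simp)
  have h1 := h k (Fin.cons (p 0) p) hwp
  have h2 := h k (Fin.cons (p 0) q) hwq
  rw [Fin.tail_cons] at h1 h2
  rw [hFE'] at h1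
  calc |β k p - β k q| ≤ |β (k + 1) (Fin.cons (p 0) q) - β k p| + |β (k + 1) (Fin.cons (p 0) q) - β k q| := by
        rw [abs_sub_comm (β (k + 1) (Fin.cons (p 0) q)) (β k p)]
        exact abs_sub_le _ _ _
    _ ≤ a k + a k := add_le_add h1 h2
    _ = 2 * a k := by ring

/-- **FE + NODE N17's BOX LETTER ⟹ `β_k` IS `2cθ^k`-FLAT IN THE BARE COUPLING ON THE WHOLE BOX** (geometric oscillation death; `a_k := c·θ^k`): the exact kernel shadow, on node N17's side,
of ym-nodeO CRIT-2's E-CRIT2-2 ∕ CRIT-1 g6's cross-read — modulo H_FE′ + the transport identification (T) the record's `β_k` oscillates by `≍ 1∕k` in the bare coupling (the marginal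
direction), so the box letter `ScaleShiftRate c θ γ` is presumptively FALSE at the current record (for every `c` and `θ < 1`).  Nothing of Bałaban asserted. [folklore] -/
theorem osc_le_of_firstEntryOnly_scaleShiftRate {c θ : ℝ}
    (hFE : ∀ (k : ℕ) (p q : Fin (k + 1) → ℝ), p ∈ Box γ k → q ∈ Box γ k → p 0 = q 0 → β k p = β k q)
    (hS : ScaleShiftRate c θ γ β) (k : ℕ) (p q : Fin (k + 1) → ℝ) (hp : p ∈ Box γ k) (hq : q ∈ Box γ k) :
    |β k p - β k q| ≤ 2 * c * θ ^ k := by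
  have := osc_le_of_firstEntryOnly_boxShift (a := fun k => c * θ ^ k) hFE hS k p q hp hq
  linarith

/-- **THE MARGINAL-TRANSPORT TOY REFUTES THE BOX LETTER UNDER FE** (idea-5 §11·N's factor, CRIT-2's toy): the first-entry-only family
`β_k(p) := β₀ + α·(p 0)²∕(1 + c·k·(p 0)²)` (`α > 0`, `c ≥ 0`: print's one-loop shape transported along the free run `1∕g_k² = 1∕g_0² + ck`) admits NO box shift modulus
`ScaleShiftRate c′ θ γ`, `0 ≤ θ < 1`: by `osc_le_of_firstEntryOnly_scaleShiftRate` its oscillation between the constant histories `γ` and `γ∕2` would be `≤ 2c′θ^k`, but that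
oscillation is `≥ 3αγ²∕(4(1 + ckγ²)²)` — polynomial — and `(1 + ckγ²)²θ^k → 0`.  A toy, not Bałaban's β; it shows which keying the F-E shadow kills. [folklore] -/
theorem not_scaleShiftRate_transportToy {β₀ α c γ : ℝ} (hα : 0 < α) (hc : 0 ≤ c) (hγ : 0 < γ) :
    ¬ ∃ c' θ : ℝ, 0 ≤ θ ∧ θ < 1 ∧ ScaleShiftRate c' θ γ (fun k p => β₀ + α * (p 0) ^ 2 / (1 + c * k * (p 0) ^ 2)) := by
  rintro ⟨c', θ, hθ0, hθ1, hS⟩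
  have hFE : ∀ (k : ℕ) (p q : Fin (k + 1) → ℝ), p ∈ Box γ k → q ∈ Box γ k → p 0 = q 0 →
      (fun k p => β₀ + α * (p 0) ^ 2 / (1 + c * k * (p 0) ^ 2) : HBeta) k p
        = (fun k p => β₀ + α * (p 0) ^ 2 / (1 + c * k * (p 0) ^ 2) : HBeta) k q := by
    intro k p q _ _ h0
    simp only [h0]
  -- the oscillation between the constant histories γ and γ/2
  have hosc : ∀ k : ℕ, 3 * α * γ ^ 2 / (4 * (1 + c * k * γ ^ 2) ^ 2) ≤ 2 * c' * θ ^ k := by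
    intro k
    have hp : (fun _ : Fin (k + 1) => γ) ∈ Box γ k := mem_box.mpr fun _ => ⟨hγ, le_rfl⟩
    have hq : (fun _ : Fin (k + 1) => γ / 2) ∈ Box γ k := mem_box.mpr fun _ => ⟨by positivity, by linarith⟩
    have h := osc_le_of_firstEntryOnly_scaleShiftRate hFE hS k _ _ hp hq
    have hk : (0 : ℝ) ≤ c * k * γ ^ 2 := by positivity
    have hD1 : 0 < 1 + c * k * γ ^ 2 := by linarith
    have hD2 : 0 < 1 + c * k * (γ / 2) ^ 2 := by positivity
    have e₁ : β₀ + α * γ ^ 2 / (1 + c * k * γ ^ 2) - (β₀ + α * (γ / 2) ^ 2 / (1 + c * k * (γ / 2) ^ 2))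
        = α * (3 * γ ^ 2) / (4 * ((1 + c * k * γ ^ 2) * (1 + c * k * (γ / 2) ^ 2))) := by
      field_simp
      ring
    have hval : 3 * α * γ ^ 2 / (4 * (1 + c * k * γ ^ 2) ^ 2)
        ≤ α * (3 * γ ^ 2) / (4 * ((1 + c * k * γ ^ 2) * (1 + c * k * (γ / 2) ^ 2))) := by
      have hle : 1 + c * k * (γ / 2) ^ 2 ≤ 1 + c * k * γ ^ 2 := by nlinarith
      rw [div_le_div_iff₀ (by positivity) (by positivity)]
      have : 0 ≤ α * (3 * γ ^ 2) * (4 * (1 + c * k * γ ^ 2)) := by positivity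
      nlinarith [mul_le_mul_of_nonneg_left hle this]
    have h0 : |β₀ + α * γ ^ 2 / (1 + c * k * γ ^ 2) - (β₀ + α * (γ / 2) ^ 2 / (1 + c * k * (γ / 2) ^ 2))| ≤ 2 * c' * θ ^ k := h
    rw [e₁, abs_of_nonneg (by positivity)] at h0
    exact hval.trans h0
  -- (1 + ckγ²)² θ^k → 0, contradiction
  have hlim : Tendsto (fun k : ℕ => (1 + c * k * γ ^ 2) ^ 2 * θ ^ k) atTop (𝓝 0) := by
    have h0 := tendsto_pow_const_mul_const_pow_of_lt_one 0 hθ0 hθ1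
    have h1 := tendsto_pow_const_mul_const_pow_of_lt_one 1 hθ0 hθ1
    have h2 := tendsto_pow_const_mul_const_pow_of_lt_one 2 hθ0 hθ1
    have e : (fun k : ℕ => (1 + c * k * γ ^ 2) ^ 2 * θ ^ k)
        = fun k : ℕ => ((k : ℝ) ^ 0 * θ ^ k) + (2 * c * γ ^ 2) * ((k : ℝ) ^ 1 * θ ^ k) + (c ^ 2 * γ ^ 4) * ((k : ℝ) ^ 2 * θ ^ k) := by
      funext k
      ring
    rw [e]
    have := (h0.add (h1.const_mul (2 * c * γ ^ 2))).add (h2.const_mul (c ^ 2 * γ ^ 4))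
    simpa using this
  have hpos : 0 < 3 * α * γ ^ 2 / (8 * max c' 1) := by positivity
  obtain ⟨k, hk⟩ := ((hlim.eventually (gt_mem_nhds hpos))).exists
  have hk' := hosc k
  have hD : 0 < (1 + c * k * γ ^ 2) ^ 2 := by positivity
  -- 3αγ²/(4D) ≤ 2c'θ^k and D θ^k < 3αγ²/(8 max c' 1) ⇒ contradiction
  have hc'le : c' ≤ max c' 1 := le_max_left _ _
  have hm : 0 < max c' 1 := lt_max_of_lt_right one_pos
  have h3 : 3 * α * γ ^ 2 ≤ 2 * c' * θ ^ k * (4 * (1 + c * k * γ ^ 2) ^ 2) := by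
    have := hk'
    rwa [div_le_iff₀ (by positivity)] at this
  have h4 : 2 * c' * θ ^ k * (4 * (1 + c * k * γ ^ 2) ^ 2) ≤ 8 * max c' 1 * ((1 + c * k * γ ^ 2) ^ 2 * θ ^ k) := by
    have hθk : 0 ≤ θ ^ k := pow_nonneg hθ0 _
    nlinarith [mul_nonneg hθk hD.le, mul_le_mul_of_nonneg_right hc'le (mul_nonneg hθk hD.le)]
  have h5 : 8 * max c' 1 * ((1 + c * k * γ ^ 2) ^ 2 * θ ^ k) < 8 * max c' 1 * (3 * α * γ ^ 2 / (8 * max c' 1)) :=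
    mul_lt_mul_of_pos_left hk (by positivity)
  have h6 : 8 * max c' 1 * (3 * α * γ ^ 2 / (8 * max c' 1)) = 3 * α * γ ^ 2 := by
    field_simp
  linarith

end FirstEntry

/-! ## §2 Under the TRANSPORT READING ON RUNS the two-run letter is EXACTLY the Markov scale shift at the realised coupling -/

section RunReading

variable {β : HBeta} {a : ℕ → ℝ} {γ : ℝ}

/-- **(T) ON RUNS ⟹ (TR)**: if along every in-window run the last fluctuation integral's β READS THE CURRENT COUPLING through a scale-indexed one-variable law `φ_k`
(`β_k(g_0,…,g_k) = φ_k(g_k)` on in-window runs — CRIT-2's transport identification (T) stated on runs; [I] (0.20) p. 256 writes literally «β_{k+1}(g_k)»), then the IR-matched two-run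
shift is EXACTLY `|φ_{k+1}(g) − φ_k(g)|` at the common endpoint `g`, hence bounded by any modulus `a_k` of the law's OWN scale dependence at fixed coupling — pv16's Markov reading of
NE4 (`scaleShiftRate_ofMarkov_iff`), read only at realised couplings.  Under FE + (T) this survives where the box letter dies (§1). [cite: Balaban1987RG1, (0.20) p.256 and (1.20)-(1.22) p.264] -/
theorem twoRunShift_of_runReading {φ : ℕ → ℝ → ℝ}
    (hR : ∀ (k : ℕ) (gs : ℕ → ℝ), RGEqH k β gs → Step.InInterval γ k gs → β k (prefixOf gs k) = φ k (gs k))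
    (hφ : ∀ (k : ℕ) (g : ℝ), 0 < g → g ≤ γ → |φ (k + 1) g - φ k g| ≤ a k) :
    ∀ (k : ℕ) (gs hs : ℕ → ℝ), RGEqH (k + 1) β gs → Step.InInterval γ (k + 1) gs → RGEqH k β hs → Step.InInterval γ k hs →
      hs k = gs (k + 1) → |β (k + 1) (prefixOf gs (k + 1)) - β k (prefixOf hs k)| ≤ a k := by
  intro k gs hs hg hIg hh hIh hend
  rw [hR (k + 1) gs hg hIg, hR k hs hh hIh, hend]
  exact hφ k (gs (k + 1)) (hIg (k + 1) le_rfl).1 (hIg (k + 1) le_rfl).2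

/-- … and for a SCALE-FREE law (`φ_k = φ₀` for all `k`) the two-run shift VANISHES identically on every IR-matched pair (`a ≡ 0`). [folklore] -/
theorem twoRunShift_zero_of_runReading_scaleFree {φ₀ : ℝ → ℝ}
    (hR : ∀ (k : ℕ) (gs : ℕ → ℝ), RGEqH k β gs → Step.InInterval γ k gs → β k (prefixOf gs k) = φ₀ (gs k)) :
    ∀ (k : ℕ) (gs hs : ℕ → ℝ), RGEqH (k + 1) β gs → Step.InInterval γ (k + 1) gs → RGEqH k β hs → Step.InInterval γ k hs →
      hs k = gs (k + 1) → |β (k + 1) (prefixOf gs (k + 1)) - β k (prefixOf hs k)| ≤ (fun _ => (0 : ℝ)) k :=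
  twoRunShift_of_runReading (φ := fun _ => φ₀) hR fun k g _ _ => by simp

/-- MARKOVIAN FAMILIES READ THE CURRENT COUPLING BY CONSTRUCTION: `FlowStep.ofMarkov βM` satisfies (T) on runs (indeed on every history) with `φ_k := βM (k+1)` (`rfl`). [folklore] -/
theorem runReading_ofMarkov (βM : ℕ → ℝ → ℝ) :
    ∀ (k : ℕ) (gs : ℕ → ℝ), RGEqH k (ofMarkov βM) gs → Step.InInterval γ k gs → ofMarkov βM k (prefixOf gs k) = βM (k + 1) (gs k) :=
  fun _ _ _ _ => rfl

/-- CONSISTENCY WITH pv16: for a Markovian family the BOX letter `ScaleShiftRate c θ γ (ofMarkov βM)` (= `|βM (k+2) g − βM (k+1) g| ≤ cθ^k` on `]0,γ]`,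
`scaleShiftRate_ofMarkov_iff`) gives (TR) with the same modulus — for Markovian families the box and two-run keyings agree; their divergence is a FIRST-ENTRY phenomenon (§1). [folklore] -/
theorem twoRunShift_ofMarkov_of_scaleShiftRate {βM : ℕ → ℝ → ℝ} {c θ : ℝ} (hS : ScaleShiftRate c θ γ (ofMarkov βM)) :
    ∀ (k : ℕ) (gs hs : ℕ → ℝ), RGEqH (k + 1) (ofMarkov βM) gs → Step.InInterval γ (k + 1) gs → RGEqH k (ofMarkov βM) hs →
      Step.InInterval γ k hs → hs k = gs (k + 1) →
      |ofMarkov βM (k + 1) (prefixOf gs (k + 1)) - ofMarkov βM k (prefixOf hs k)| ≤ c * θ ^ k :=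
  twoRunShift_of_runReading (runReading_ofMarkov βM) fun k g hg hgγ => (scaleShiftRate_ofMarkov_iff.mp hS) k g hg hgγ

end RunReading

/-! ## §3 FILE 6's two-run lever under the transport reading on runs -/

section Lever

variable {β : HBeta} {b a e : ℕ → ℝ} {γ : ℝ}

/-- ★ **(T) ON RUNS + A SUMMABLE MARKOV SCALE SHIFT OF THE READ LAW + CORNER STEP + ANCHOR + (ER) ⟹ EVERY RUN-WISE CONSTANT REMAINDER** (FILE 6's
`exists_runConstRemainder_of_twoRunShift_cornerStep_scaleAnchor_endRuns` ∘ `twoRunShift_of_runReading`): what DEF-1's `RunConstRemainder` needs of NE4, under the transport reading, is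
the summable scale dependence `|φ_{k+1}(g) − φ_k(g)| ≤ a_k` of the read law AT FIXED COUPLING — no box letter, no history modulus, no geometric rate.  CONDITIONAL on all binders.
[cite: Balaban1987RG1, (0.20) p.256, Thm 2 p.259 and (2.12)-(2.14) p.268] -/
theorem exists_runConstRemainder_of_runReading_scaleAnchor_endRuns (hγ : 0 < γ) (hA : ScaleAnchor β b) {φ : ℕ → ℝ → ℝ}
    (hR : ∀ (k : ℕ) (gs : ℕ → ℝ), RGEqH k β gs → Step.InInterval γ k gs → β k (prefixOf gs k) = φ k (gs k))
    (hφ : ∀ (k : ℕ) (g : ℝ), 0 < g → g ≤ γ → |φ (k + 1) g - φ k g| ≤ a k) (ha : Summable a)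
    (hb : ∀ k, |b (k + 1) - b k| ≤ e k) (he : Summable e)
    (hE : ∀ γ' : ℝ, 0 < γ' → γ' ≤ γ → ∀ (k : ℕ) (g : ℝ), 0 < g → g ≤ γ' →
      ∃ hs : ℕ → ℝ, RGEqH k β hs ∧ Step.InInterval γ' k hs ∧ hs k = g)
    {s : ℝ} (hs : 0 < s) : ∃ γs : ℝ, 0 < γs ∧ γs ≤ γ ∧ RunConstRemainder β b s γs :=
  exists_runConstRemainder_of_twoRunShift_cornerStep_scaleAnchor_endRuns hγ hA (twoRunShift_of_runReading hR hφ) ha hb he hE hs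

variable (F : T4Family) (κ : StepColourData) (θ : Node00.Stage13HParams F 2) (hP : θ.Provisos₁₃SepCoPH F 2)

/-- ★★ **AT NODE 00's STAGE-13 RECORD: (T) on the runs of the datum's β with a SUMMABLE Markov scale shift + (ER) + the anchor at the named numbers + one-level (C) ⟹ DEF-1's
`RunRemAt F κ θ hP θ.cβ`** (FILE 6's ★★ ∘ `twoRunShift_of_runReading`).  CONDITIONAL; none of the binders is proved, and whether the record's β admits the transport reading is the
F-E repair desk's question, not settled here. [cite: Balaban1987RG1, (0.20) p.256, Thm 3 p.264 and (2.12)-(2.14) p.268] -/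
theorem runRemAt_of_runReading_scaleAnchor_endRuns_survContAt (hθ : θ.Admissible F 2) {φ : ℕ → ℝ → ℝ} {a : ℕ → ℝ} (ha : Summable a)
    (hR : ∀ (k : ℕ) (gs : ℕ → ℝ), RGEqH k (Node00.datumOfRecord₁₃SepCoPH F 2 θ hP).βfun gs → Step.InInterval θ.γ k gs →
      (Node00.datumOfRecord₁₃SepCoPH F 2 θ hP).βfun k (prefixOf gs k) = φ k (gs k))
    (hφ : ∀ (k : ℕ) (g : ℝ), 0 < g → g ≤ θ.γ → |φ (k + 1) g - φ k g| ≤ a k)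
    (hE : ∀ γ' : ℝ, 0 < γ' → γ' ≤ θ.γ → ∀ (k : ℕ) (g : ℝ), 0 < g → g ≤ γ' →
      ∃ hs : ℕ → ℝ, RGEqH k (Node00.datumOfRecord₁₃SepCoPH F 2 θ hP).βfun hs ∧ Step.InInterval γ' k hs ∧ hs k = g)
    (hA : ScaleAnchor (Node00.datumOfRecord₁₃SepCoPH F 2 θ hP).βfun (fun k => θ.cβ * beta0OfJs F κ k))
    {γ₀ : ℝ} (hγ₀ : 0 < γ₀) (hsc : SurvCont (Node00.datumOfRecord₁₃SepCoPH F 2 θ hP).βfun γ₀) :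
    RunRemAt F κ θ hP θ.cβ :=
  runRemAt_of_twoRunShift_scaleAnchor_endRuns_survContAt F κ θ hP hθ ha (twoRunShift_of_runReading hR hφ) hE hA hγ₀ hsc

end Lever

end Summit.QuantumFields.YangMills.BalabanUVNodes.N17TwoRunShiftFirstEntry

end
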